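import Literature.MathematicalPhysics.QuantumFieldTheory.Balaban1983to89.T4OutputRate
import Literature.MathematicalPhysics.QuantumFieldTheory.King1986.MinimizerTwoSpacing

/-!
# BalabanUVNodes ∕ N18 — the statement of record `T4OutputRate.NE5` INHABITED WITH CONTENT by its PRINTED MODEL:
# King 1986 Prop. 3.8 (3.71), first line, on the torus (`King1986.Torus.king_prop38_torus`) ⇒ `NE5` BY NAME at every
# carrier reading King's two-spacing minimiser kernels, rate `θ = L^{−γ} < 1`, ONE `k`-uniform constant (Track A, DAG node N18)

HONEST FRAMING.  Count-neutral kernel bookkeeping; NOT a node discharge.  The functionals instantiated here are KING'S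
`A = 0` SCALAR MINIMISER KERNELS `ℋ_k = a_kG^η_kQ^*_k` of the U(1) Higgs model ([King1986], TEMPLATE literature, printed and
proved) — NOT Bałaban's covariant one-step outputs `E^{(j)}(X; g, U)` of [Balaban1987RG1] (0.24), for which NE5 is NOT IN
PRINT and has no tree producer (NODE O instance 0∕1; seat README «No tree producer»).  What this file adds to the N18 row
is the POSITIVE face of referee ref-B's A6 (READ #3): the hypothesis SHAPE of record `T4OutputRate.NE5 EA EB W κ θ C₅`
(T4OutputRate.lean :211), which is trivially true for `θ ≥ 1` under one-run decay bounds
(`BalabanUVNodesN18End.ne5_of_decayBounds_one_le`), is satisfied WITH CONTENT — `θ = L^{−γ} < 1` for every `γ ∈ ]0, 1]`,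
ONE constant for ALL scales, uniformly in the volume and the mass — by the printed model of the mechanism the node
postulates ([King1986] p. 665: *"the error is the same graph with a difference of propagators on one line … Proposition
3.8 gives the desired factor L^{−γk}"*), exactly as the twin seat `dag-n18-b` typed and proved it
(`King1986/MinimizerTwoSpacing.lean`, p410885).  One finite torus at a time; nothing continuum ∕ ℝ⁴ ∕ OS ∕ mass-gap ∕
Clay.  0 `sorry`, 0 `def`, standard axioms.

THE KNIT (the -a∕-b loop of ROSTER-D0062: -b's first missing estimate, landed, is knitted into the DECL of record by name).
`NE5 EA EB W κ θ C₅` reads: for every coupling sequence `g ∈ W`, run-B background `U` and domain `X` born at scale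
`j = scale X`, `|EA g (transport U) X − EB g U X| ≤ C₅·θ^j·e^{−κ·d X}`.  King's Prop. 3.8 line 1 on the torus
(`king_prop38_torus`): on the unit torus `Π_μ ℤ∕M_μ` with fine tori of `L^k` and `L^nL^k` points per block side (`L` odd,
`L ≥ 2`, `k, n ≥ 1`), `|ℋ_{k+n}(x′, b) − ℋ_k(x, b)| ≤ (C₁(k,n) + C₂)·(L^k)^{−γ}` for the coarse point `x` under `x′`, every
unit site `b`, `0 ≤ γ ≤ 1`, with closed constants whose only `k, n`-dependence is through `a_k, a_n ∈ [a(1 − L⁻²), a]`.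
§1 majorises that dependence away (`lemma43Const_le_unif`, `prop38Const_le_unif`: ONE constant `C₅(a, L, d, γ)`);
§2 rewrites the rate `(L^k)^{−γ} = (L^{−γ})^k` as NE5's geometric factor and records `0 < L^{−γ} < 1` for `γ > 0`;
§3 `ne5_of_kingModel`: at ANY carriers `C` with `scale ≥ 1` and ANY pair of functionals that READ King's kernels through
coordinate maps `X ↦ (b(X), x_A(X), x_B(X))` (run A at `L^{scale X}`, run B at `L^nL^{scale X}`, `x_A` under `x_B`) — the
coupling sequence and the backgrounds are not read (King's model has `A = 0` and no running coupling) — `NE5 EA EB W 0 θ C₅`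
holds with `θ = L^{−γ}`, the uniform `C₅`, EVERY window `W`, decay exponent `κ = 0` (sup norm: Prop. 3.8 line 1 before
"combining with Theorem 3.3"); §4 `ne5_of_kingModel_decay`: WITH Theorem 3.3's decay of both kernels in the carriers' tree
length as binders (`|ℋ(·)| ≤ c₀e^{−δ₀·d X}` — the input `king_prop38_torus_of_decay` takes; the twin's bridge to the B1∕B4
torus tower `B4Thm110ZeroTorus.thm110_zero_torus` is to discharge it), `NE5 EA EB W (δ₀∕2) (L^{−γ∕2}) √(2c₀C₅)` — the printed
shape `CL^{−γ′k}e^{−δ₀′|x−z|}` of (3.71); §5 `ne5_kingModel_inhabited`: a LITERAL carrier (domains `Σ k, Ω × T_{η′}` with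
`scale = k + 1`, trivial backgrounds, transport `id`) at which §3 applies — `NE5` is inhabited with `θ < 1` in the kernel;
§6 `decayBound_of_kingModel_A∕_B`: the SAME reading inhabits the one-run envelope shape `DecayBound · W A 0` of both runs
(King's uniform size bound `abs_minimiser_kernel_le_unif`, `a_k ≤ a`) — so the model carries the envelopes AND a rate
`θ < 1`, the content A6 isolates; §7 the K4 family shape `∀ b ∈ ]0, γ′], NE5 EA (EB b) …` (dagwriter `N18At`) for the
constant family.

Sources: C. King, *The U(1) Higgs model. I. The continuum limit*, Commun. Math. Phys. **102** (1986) 649–677 [King1986],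
Prop. 3.8 (3.71) p. 664, §4 pp. 670–674, p. 665; T. Bałaban, Commun. Math. Phys. **109** (1987) 249–301 [Balaban1987RG1]
(0.24)–(0.25) p. 257, Thm 1 p. 259 (uniformity in ε — the only printed trace of NE5).  Nothing here is a claim about the
Yang–Mills mass gap.
-/

noncomputable section

namespace Summit.QuantumFields.YangMills.BalabanUVNodes.N18KingModel

open Real
open Literature.MathematicalPhysics.QuantumFieldTheory.Balaban1983to89.T4OutputRate (Carriers Functional NE5 DecayBound)
open Literature.MathematicalPhysics.QuantumFieldTheory.Balaban1983to89.B5Prop11Plancherel (Tor fine)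
open Literature.MathematicalPhysics.QuantumFieldTheory.King1986
  (aK aK_pos aK_le aK_ge lemma43Const lemma43Const_nonneg prop38RateConst prop38PosConst nearRateConst
    centralRateConst aliasConst aliasTerm_nonneg alias_sum_le)
open Literature.MathematicalPhysics.QuantumFieldTheory.King1986.Torus
  (minimiser king_prop38_torus king_prop38_torus_of_decay abs_minimiser_kernel_le_unif)

/-! ## §1 ONE constant for all scales: King's `k, n`-dependence majorised over `a_k, a_n ∈ [a(1 − L⁻²), a]` -/

/-- King's Lemma 4.3 constant `θ_{k,n} = 2a_k(a_n⁻¹ + π²∕48 + 1∕3)` is at most `2a((a(1 − L⁻²))⁻¹ + π²∕48 + 1∕3)`, uniformly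
in `k, n ≥ 1` (`a(1 − L⁻²) ≤ a_j ≤ a`, (2.13)). [cite: King1986, Lemma 4.3 (4.18) p.672, (2.13) p.653] -/
theorem lemma43Const_le_unif {a : ℝ} (ha : 0 < a) {L : ℕ} (hL : 2 ≤ L) {k n : ℕ} (hk : 1 ≤ k) (hn : 1 ≤ n) :
    lemma43Const a L k n ≤ a * (2 * ((a * (1 - ((L : ℝ) ^ 2)⁻¹))⁻¹ + π ^ 2 / 48 + 1 / 3)) := by
  have hLr : (1 : ℝ) < L := by exact_mod_cast (lt_of_lt_of_le one_lt_two hL)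
  have h1 : aK a L k ≤ a := aK_le ha hLr hk
  have h2 : a * (1 - ((L : ℝ) ^ 2)⁻¹) ≤ aK a L n := aK_ge ha hLr hn
  have hlow : 0 < a * (1 - ((L : ℝ) ^ 2)⁻¹) := by
    have hL2 : (1 : ℝ) < (L : ℝ) ^ 2 := by nlinarith
    have : ((L : ℝ) ^ 2)⁻¹ < 1 := inv_lt_one_of_one_lt₀ hL2
    exact mul_pos ha (by linarith)
  have h3 : (aK a L n)⁻¹ ≤ (a * (1 - ((L : ℝ) ^ 2)⁻¹))⁻¹ := inv_anti₀ hlow h2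
  have h5 : 0 ≤ 2 * ((aK a L n)⁻¹ + π ^ 2 / 48 + 1 / 3) := by
    have : 0 ≤ (aK a L n)⁻¹ := inv_nonneg.2 (hlow.le.trans h2)
    positivity
  unfold lemma43Const
  calc aK a L k * (2 * ((aK a L n)⁻¹ + π ^ 2 / 48 + 1 / 3))
      ≤ a * (2 * ((aK a L n)⁻¹ + π ^ 2 / 48 + 1 / 3)) := mul_le_mul_of_nonneg_right h1 h5
    _ ≤ a * (2 * ((a * (1 - ((L : ℝ) ^ 2)⁻¹))⁻¹ + π ^ 2 / 48 + 1 / 3)) := by gcongr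

/-- King's assembled rate constant is monotone in the Lemma 4.3 letter `θ` (it enters linearly with nonnegative
coefficients). [cite: King1986, Prop. 3.8 p.664 with (4.22)–(4.31) pp.672–673] -/
theorem prop38RateConst_mono {aA aB θ θ' K : ℝ} {d : ℕ} {γ : ℝ} (haA : 0 ≤ aA) (hK : 0 ≤ K)
    (hAC : 0 ≤ aliasConst d (γ - 1)) (hθ : θ ≤ θ') :
    prop38RateConst aA aB θ K d γ ≤ prop38RateConst aA aB θ' K d γ := by
  have hpd : 0 ≤ (π / 2) ^ d := pow_nonneg (by positivity) d
  have h1 : nearRateConst aA θ d γ ≤ nearRateConst aA θ' d γ := by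
    unfold nearRateConst
    exact mul_le_mul_of_nonneg_left (by nlinarith [pi_pos]) (mul_nonneg haA hpd)
  have h2 : centralRateConst aA θ K d γ ≤ centralRateConst aA θ' K d γ := by
    unfold centralRateConst
    refine mul_le_mul_of_nonneg_left ?_ hpd
    nlinarith [mul_nonneg hK (sq_nonneg π)]
  unfold prop38RateConst
  nlinarith [mul_le_mul_of_nonneg_right h1 hAC]

/-- **ONE CONSTANT FOR ALL SCALES.**  King's Prop. 3.8 constant `C₁(k, n) + C₂` is at most the `k, n`-free
`C₅(a, L, d, γ) := prop38RateConst a a Θ (π²∕4)^d d γ + prop38PosConst a (π²∕4)^d d γ`, `Θ = 2a((a(1 − L⁻²))⁻¹ + π²∕48 + 1∕3)`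
(`d ≥ 1`, `γ < 2`). [cite: King1986, Prop. 3.8 (3.71) p.664, Lemma 4.3 p.672, (2.13) p.653] -/
theorem prop38Const_le_unif {d : ℕ} (hd : 0 < d) {a : ℝ} (ha : 0 < a) {L : ℕ} (hL : 2 ≤ L) {k n : ℕ} (hk : 1 ≤ k)
    (hn : 1 ≤ n) {γ : ℝ} (hγ : γ < 2) :
    prop38RateConst a a (lemma43Const a L k n) ((π ^ 2 / 4) ^ d) d γ + prop38PosConst a ((π ^ 2 / 4) ^ d) d γ
      ≤ prop38RateConst a a (a * (2 * ((a * (1 - ((L : ℝ) ^ 2)⁻¹))⁻¹ + π ^ 2 / 48 + 1 / 3))) ((π ^ 2 / 4) ^ d) d γ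
        + prop38PosConst a ((π ^ 2 / 4) ^ d) d γ := by
  -- `0 ≤ C(d, γ − 1)` ((4.22) bounds a nonnegative alias sum; cf. `GAN24.FineReadoutDecay.aliasConst_nonneg`)
  have hAC : 0 ≤ aliasConst d (γ - 1) :=
    (Finset.sum_nonneg fun j _ => aliasTerm_nonneg (γ - 1) _ j).trans
      (alias_sum_le hd (by linarith) (p := fun _ => 0) (fun μ => by rw [abs_zero]; exact pi_pos.le) 0)
  have h := prop38RateConst_mono (aB := a) (K := (π ^ 2 / 4) ^ d) (d := d) (γ := γ) ha.le (by positivity)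
    hAC (lemma43Const_le_unif ha hL hk hn)
  linarith

/-- The uniform constant is nonnegative (it dominates King's constant at `k = n = 1`, a sum of products of nonnegative
closed forms). [cite: King1986, Prop. 3.8 (3.71) p.664] -/
theorem prop38Const_unif_nonneg {d : ℕ} (hd : 0 < d) {a : ℝ} (ha : 0 < a) {L : ℕ} (hL : 2 ≤ L) {γ : ℝ}
    (hγ : γ < 2) :
    0 ≤ prop38RateConst a a (a * (2 * ((a * (1 - ((L : ℝ) ^ 2)⁻¹))⁻¹ + π ^ 2 / 48 + 1 / 3))) ((π ^ 2 / 4) ^ d) d γ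
        + prop38PosConst a ((π ^ 2 / 4) ^ d) d γ := by
  have hAC : 0 ≤ aliasConst d (γ - 1) :=
    (Finset.sum_nonneg fun j _ => aliasTerm_nonneg (γ - 1) _ j).trans
      (alias_sum_le hd (by linarith) (p := fun _ => 0) (fun μ => by rw [abs_zero]; exact pi_pos.le) 0)
  have hΘ : 0 ≤ lemma43Const a L 1 1 := lemma43Const_nonneg ha hL le_rfl le_rfl
  have h0 : 0 ≤ prop38RateConst a a (lemma43Const a L 1 1) ((π ^ 2 / 4) ^ d) d γ
      + prop38PosConst a ((π ^ 2 / 4) ^ d) d γ := by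
    unfold prop38RateConst prop38PosConst nearRateConst centralRateConst
      Literature.MathematicalPhysics.QuantumFieldTheory.King1986.nearPosConst
      Literature.MathematicalPhysics.QuantumFieldTheory.King1986.centralPosConst
    positivity
  exact h0.trans (prop38Const_le_unif hd ha hL le_rfl le_rfl hγ)

/-! ## §2 King's rate `(L^k)^{−γ}` as NE5's geometric factor `θ^k`, `θ = L^{−γ} ∈ ]0, 1[` -/

/-- `(L^k)^{−γ} = (L^{−γ})^k`. [folklore] -/
theorem rpow_neg_natPow (L k : ℕ) (γ : ℝ) : ((L ^ k : ℕ) : ℝ) ^ (-γ) = ((L : ℝ) ^ (-γ)) ^ k := by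
  have hL : (0 : ℝ) ≤ L := Nat.cast_nonneg L
  push_cast
  rw [← Real.rpow_natCast (L : ℝ) k, ← Real.rpow_mul hL, mul_comm, Real.rpow_mul hL, Real.rpow_natCast]

/-- The rate is positive: `0 < L^{−γ}` for `L ≥ 1`. [folklore] -/
theorem kingTheta_pos {L : ℕ} (hL : 1 ≤ L) (γ : ℝ) : 0 < (L : ℝ) ^ (-γ) :=
  Real.rpow_pos_of_pos (by exact_mod_cast hL) _

/-- THE CONTENT (ref-B A6): the rate is `< 1` exactly when `γ > 0` (`L ≥ 2`). [folklore] -/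
theorem kingTheta_lt_one {L : ℕ} (hL : 2 ≤ L) {γ : ℝ} (hγ : 0 < γ) : (L : ℝ) ^ (-γ) < 1 :=
  Real.rpow_lt_one_of_one_lt_of_neg (by exact_mod_cast hL) (by linarith)

/-- … and `≤ 1` for `γ ≥ 0`. [folklore] -/
theorem kingTheta_le_one {L : ℕ} (hL : 1 ≤ L) {γ : ℝ} (hγ : 0 ≤ γ) : (L : ℝ) ^ (-γ) ≤ 1 :=
  Real.rpow_le_one_of_one_le_of_nonpos (by exact_mod_cast hL) (by linarith)

/-! ## §3 `NE5` BY NAME at every carrier reading King's model (sup norm, `κ = 0`) -/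

variable {d : ℕ}

/-- **N18's DECL OF RECORD INHABITED BY ITS PRINTED MODEL (sup norm).**  Let `C` be ANY carriers with creation scales
`≥ 1`, and let the two functionals READ King's `A = 0` minimiser kernels through coordinate maps of the domains: run A's
`EA g U X = ℋ_k(x_A(X), b(X))` at `k = scale X` (fine torus of `L^k` points per unit side), run B's
`EB g U X = ℋ_{k+n}(x_B(X), b(X))` (`L^nL^k` points), `x_A(X)` the coarse point under `x_B(X)` (King: *"we denote by x that
point in T_η for which x′ ∈ B^n(x)"*) — neither reads the coupling sequence or the background (King's model has no
running coupling and `A = 0`).  Then for every window `W`: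
`NE5 EA EB W 0 (L^{−γ}) C₅`, `C₅ = C₅(a, L, d, γ)` of §1 — i.e. `|EA − EB| ≤ C₅·(L^{−γ})^{scale X}` at every domain, ONE
constant for all scales, volumes `M` and masses `m² > 0`; by `king_prop38_torus` (Prop. 3.8 (3.71) line 1).
[cite: King1986, Prop. 3.8 (3.71) p.664, pp.670–674, p.665] -/
theorem ne5_of_kingModel (hd : 0 < d) {L : ℕ} [NeZero L] (hLodd : Odd L) (hL : 2 ≤ L) {n : ℕ} (hn : 1 ≤ n)
    (M : Fin d → ℕ) [∀ μ, NeZero (M μ)] {a m2 : ℝ} (ha : 0 < a) (hm : 0 < m2) {γ : ℝ} (hγ0 : 0 ≤ γ) (hγ1 : γ ≤ 1)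
    (C : Carriers) (hscale : ∀ X, 1 ≤ C.scale X) (site : C.Dom → Tor M)
    (xA : (X : C.Dom) → Tor (fine (L ^ C.scale X) M)) (xB : (X : C.Dom) → Tor (fine (L ^ n * L ^ C.scale X) M))
    (hx : ∀ X μ, (xA X μ).val = (xB X μ).val / L ^ n)
    (EA : Functional C C.BgA) (EB : Functional C C.BgB)
    (hEA : ∀ g U X, EA g U X =
      minimiser (L ^ C.scale X) M (aK a L (C.scale X)) (((L ^ C.scale X : ℕ) : ℝ) ^ 2) m2 (Pi.single (site X) 1) (xA X))
    (hEB : ∀ g U X, EB g U X =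
      minimiser (L ^ n * L ^ C.scale X) M (aK a L (C.scale X + n)) (((L ^ n * L ^ C.scale X : ℕ) : ℝ) ^ 2) m2
        (Pi.single (site X) 1) (xB X))
    (W : Set (ℕ → ℝ)) :
    NE5 EA EB W 0 ((L : ℝ) ^ (-γ))
      (prop38RateConst a a (a * (2 * ((a * (1 - ((L : ℝ) ^ 2)⁻¹))⁻¹ + π ^ 2 / 48 + 1 / 3))) ((π ^ 2 / 4) ^ d) d γ
        + prop38PosConst a ((π ^ 2 / 4) ^ d) d γ) := by
  intro g _hg U X
  rw [hEA, hEB, abs_sub_comm, zero_mul, neg_zero, Real.exp_zero, mul_one, ← rpow_neg_natPow]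
  have hk := hscale X
  have h := king_prop38_torus hd hLodd hL hk hn M ha hm hγ0 hγ1 (site X) (xA X) (xB X) (hx X)
  have hLk : (0 : ℝ) ≤ ((L ^ C.scale X : ℕ) : ℝ) ^ (-γ) := Real.rpow_nonneg (Nat.cast_nonneg _) _
  exact h.trans (mul_le_mul_of_nonneg_right (prop38Const_le_unif hd ha hL hk hn (by linarith)) hLk)

/-! ## §4 The decay-weighted shape: «combining our bounds with Theorem 3.3» -/

/-- `√(u·s²·v) = √(u·v)·s` for `s ≥ 0`. [folklore] -/
theorem sqrt_mul_sq_mul {u s v : ℝ} (hs : 0 ≤ s) : Real.sqrt (u * s ^ 2 * v) = Real.sqrt (u * v) * s := by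
  rw [show u * s ^ 2 * v = (u * v) * s ^ 2 by ring, Real.sqrt_mul' _ (sq_nonneg s), Real.sqrt_sq hs]

/-- `L^{−γ} = (L^{−γ∕2})²`. [folklore] -/
theorem kingTheta_eq_sq (L : ℕ) (γ : ℝ) : (L : ℝ) ^ (-γ) = ((L : ℝ) ^ (-(γ / 2))) ^ 2 := by
  have hL : (0 : ℝ) ≤ L := Nat.cast_nonneg L
  rw [← Real.rpow_natCast ((L : ℝ) ^ (-(γ / 2))) 2, ← Real.rpow_mul hL]
  norm_num

/-- **N18's DECL OF RECORD INHABITED BY ITS PRINTED MODEL, DECAY-WEIGHTED.**  Same reading as `ne5_of_kingModel`; in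
addition let the carriers' tree length `d X` be a length in which BOTH kernels decay at the domain's point pair,
`|ℋ_k(x_A(X), b(X))|, |ℋ_{k+n}(x_B(X), b(X))| ≤ c₀·e^{−δ₀·d X}` (Theorem 3.3's uniform decay — an INPUT here, as in
`king_prop38_torus_of_decay`; in the tree in the B1∕B4 torus-tower currency, `B4Thm110ZeroTorus.thm110_zero_torus`).  Then
for every window `W`: `NE5 EA EB W (δ₀∕2) (L^{−γ∕2}) √(2c₀·C₅)` — the printed shape `CL^{−γ′k}e^{−δ₀′|x − z|}` of (3.71)
with `γ′ = γ∕2`, `δ₀′ = δ₀∕2`, BY NAME. [cite: King1986, Prop. 3.8 (3.71) p.664, p.674, p.665] -/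
theorem ne5_of_kingModel_decay (hd : 0 < d) {L : ℕ} [NeZero L] (hLodd : Odd L) (hL : 2 ≤ L) {n : ℕ} (hn : 1 ≤ n)
    (M : Fin d → ℕ) [∀ μ, NeZero (M μ)] {a m2 : ℝ} (ha : 0 < a) (hm : 0 < m2) {γ : ℝ} (hγ0 : 0 ≤ γ) (hγ1 : γ ≤ 1)
    (C : Carriers) (hscale : ∀ X, 1 ≤ C.scale X) (site : C.Dom → Tor M)
    (xA : (X : C.Dom) → Tor (fine (L ^ C.scale X) M)) (xB : (X : C.Dom) → Tor (fine (L ^ n * L ^ C.scale X) M))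
    (hx : ∀ X μ, (xA X μ).val = (xB X μ).val / L ^ n)
    (EA : Functional C C.BgA) (EB : Functional C C.BgB)
    (hEA : ∀ g U X, EA g U X =
      minimiser (L ^ C.scale X) M (aK a L (C.scale X)) (((L ^ C.scale X : ℕ) : ℝ) ^ 2) m2 (Pi.single (site X) 1) (xA X))
    (hEB : ∀ g U X, EB g U X =
      minimiser (L ^ n * L ^ C.scale X) M (aK a L (C.scale X + n)) (((L ^ n * L ^ C.scale X : ℕ) : ℝ) ^ 2) m2
        (Pi.single (site X) 1) (xB X))
    {c₀ δ₀ : ℝ}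
    (hdecA : ∀ X, |minimiser (L ^ C.scale X) M (aK a L (C.scale X)) (((L ^ C.scale X : ℕ) : ℝ) ^ 2) m2
      (Pi.single (site X) 1) (xA X)| ≤ c₀ * Real.exp (-(δ₀ * C.d X)))
    (hdecB : ∀ X, |minimiser (L ^ n * L ^ C.scale X) M (aK a L (C.scale X + n))
      (((L ^ n * L ^ C.scale X : ℕ) : ℝ) ^ 2) m2 (Pi.single (site X) 1) (xB X)| ≤ c₀ * Real.exp (-(δ₀ * C.d X)))
    (W : Set (ℕ → ℝ)) :
    NE5 EA EB W (δ₀ / 2) ((L : ℝ) ^ (-(γ / 2)))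
      (Real.sqrt (2 * c₀ *
        (prop38RateConst a a (a * (2 * ((a * (1 - ((L : ℝ) ^ 2)⁻¹))⁻¹ + π ^ 2 / 48 + 1 / 3))) ((π ^ 2 / 4) ^ d) d γ
          + prop38PosConst a ((π ^ 2 / 4) ^ d) d γ))) := by
  intro g _hg U X
  rw [hEA, hEB, abs_sub_comm]
  have hk := hscale X
  have h := king_prop38_torus_of_decay hd hLodd hL hk hn M ha hm hγ0 hγ1 (site X) (xA X) (xB X) (hx X)
    (hdecA X) (hdecB X)
  refine h.trans ?_
  -- `c₀ ≥ 0` (it dominates an absolute value times a positive exponential)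
  have hc₀ : 0 ≤ c₀ := by
    have h1 := (abs_nonneg _).trans (hdecA X)
    exact nonneg_of_mul_nonneg_left h1 (Real.exp_pos _)
  -- the rate: `(L^k)^{−γ} = ((L^{−γ∕2})^k)²`
  set s : ℝ := (L : ℝ) ^ (-(γ / 2)) with hs_def
  have hs : 0 ≤ s := Real.rpow_nonneg (Nat.cast_nonneg _) _
  have hrate : ((L ^ C.scale X : ℕ) : ℝ) ^ (-γ) = (s ^ C.scale X) ^ 2 := by
    rw [rpow_neg_natPow, kingTheta_eq_sq, ← pow_mul, ← pow_mul, mul_comm]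
  set Ck : ℝ := prop38RateConst a a (lemma43Const a L (C.scale X) n) ((π ^ 2 / 4) ^ d) d γ
    + prop38PosConst a ((π ^ 2 / 4) ^ d) d γ with hCk
  set Cu : ℝ := prop38RateConst a a (a * (2 * ((a * (1 - ((L : ℝ) ^ 2)⁻¹))⁻¹ + π ^ 2 / 48 + 1 / 3)))
      ((π ^ 2 / 4) ^ d) d γ + prop38PosConst a ((π ^ 2 / 4) ^ d) d γ with hCu
  have hCle : Ck ≤ Cu := prop38Const_le_unif hd ha hL hk hn (by linarith)
  have hsq : Real.sqrt (Ck * ((L ^ C.scale X : ℕ) : ℝ) ^ (-γ) * (2 * c₀)) = Real.sqrt (Ck * (2 * c₀)) * s ^ C.scale X := by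
    rw [hrate, sqrt_mul_sq_mul (pow_nonneg hs _)]
  have hmono : Real.sqrt (Ck * (2 * c₀)) ≤ Real.sqrt (2 * c₀ * Cu) := by
    rw [mul_comm Ck]
    exact Real.sqrt_le_sqrt (mul_le_mul_of_nonneg_left hCle (by positivity))
  rw [hsq]
  calc Real.sqrt (Ck * (2 * c₀)) * s ^ C.scale X * Real.exp (-(δ₀ / 2 * C.d X))
      ≤ Real.sqrt (2 * c₀ * Cu) * s ^ C.scale X * Real.exp (-(δ₀ / 2 * C.d X)) := by gcongr

/-! ## §5 A LITERAL inhabitant: King's carriers (domains `Σ k, Ω × T_{η′}`, scale `k + 1`, trivial backgrounds) -/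

/-- The coarse point under a fine point: `⌊x′_μ∕L^n⌋` is a residue of the coarse torus (`x′_μ < L^nL^kM_μ`). [folklore] -/
theorem coarse_val {L n N : ℕ} [NeZero L] [NeZero N] {M : Fin d → ℕ} [∀ μ, NeZero (M μ)] (hLn : 0 < L ^ n)
    (x' : Tor (fine (L ^ n * N) M)) (μ : Fin d) :
    ((((x' μ).val / L ^ n : ℕ) : ZMod (fine N M μ))).val = (x' μ).val / L ^ n := by
  rw [ZMod.val_natCast, Nat.mod_eq_of_lt]
  have hlt : (x' μ).val < L ^ n * N * M μ := ZMod.val_lt (x' μ)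
  rw [Nat.div_lt_iff_lt_mul hLn]
  show (x' μ).val < N * M μ * L ^ n
  calc (x' μ).val < L ^ n * N * M μ := hlt
    _ = N * M μ * L ^ n := by ring

/-- **`NE5` INHABITED WITH `θ < 1` IN THE KERNEL (literal carriers).**  Domains: a scale `k` (creation scale `k + 1`), a
unit site `b ∈ Π_μ ℤ∕M_μ` and run B's fine point `x′`; tree length `0`; both background carriers trivial, transport `id`,
gauge `0`; run A reads `ℋ_{k+1}` at the coarse point under `x′`, run B reads `ℋ_{k+1+n}` at `x′`.  For `0 < γ ≤ 1` the
rate `L^{−γ}` is `< 1` (`kingTheta_lt_one`). [cite: King1986, Prop. 3.8 (3.71) p.664, p.665] -/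
theorem ne5_kingModel_inhabited (hd : 0 < d) {L : ℕ} [NeZero L] (hLodd : Odd L) (hL : 2 ≤ L) {n : ℕ} (hn : 1 ≤ n)
    (M : Fin d → ℕ) [∀ μ, NeZero (M μ)] {a m2 : ℝ} (ha : 0 < a) (hm : 0 < m2) {γ : ℝ} (hγ0 : 0 ≤ γ) (hγ1 : γ ≤ 1)
    (W : Set (ℕ → ℝ)) :
    NE5 (C := { Dom := Σ k : ℕ, Tor M × Tor (fine (L ^ n * L ^ (k + 1)) M), scale := fun X => X.1 + 1,
                d := fun _ => 0, d_nonneg := fun _ => le_rfl, BgA := PUnit, BgB := PUnit,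
                gauge := fun _ _ => 0, gauge_nonneg := fun _ _ => le_rfl, transport := id })
      (fun (_ : ℕ → ℝ) (_ : PUnit) (X : Σ k : ℕ, Tor M × Tor (fine (L ^ n * L ^ (k + 1)) M)) =>
        minimiser (L ^ (X.1 + 1)) M (aK a L (X.1 + 1)) (((L ^ (X.1 + 1) : ℕ) : ℝ) ^ 2) m2
          (Pi.single X.2.1 1) (fun μ => (((X.2.2 μ).val / L ^ n : ℕ) : ZMod (fine (L ^ (X.1 + 1)) M μ))))
      (fun (_ : ℕ → ℝ) (_ : PUnit) (X : Σ k : ℕ, Tor M × Tor (fine (L ^ n * L ^ (k + 1)) M)) =>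
        minimiser (L ^ n * L ^ (X.1 + 1)) M (aK a L (X.1 + 1 + n)) (((L ^ n * L ^ (X.1 + 1) : ℕ) : ℝ) ^ 2)
          m2 (Pi.single X.2.1 1) X.2.2)
      W 0 ((L : ℝ) ^ (-γ))
      (prop38RateConst a a (a * (2 * ((a * (1 - ((L : ℝ) ^ 2)⁻¹))⁻¹ + π ^ 2 / 48 + 1 / 3))) ((π ^ 2 / 4) ^ d) d γ
        + prop38PosConst a ((π ^ 2 / 4) ^ d) d γ) := by
  have hLn : 0 < L ^ n := pow_pos (Nat.pos_of_ne_zero (NeZero.ne L)) n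
  -- the carriers literal is repeated so that the reading maps elaborate against a closed structure
  exact ne5_of_kingModel hd hLodd hL hn M ha hm hγ0 hγ1
    { Dom := Σ k : ℕ, Tor M × Tor (fine (L ^ n * L ^ (k + 1)) M), scale := fun X => X.1 + 1,
      d := fun _ => 0, d_nonneg := fun _ => le_rfl, BgA := PUnit, BgB := PUnit,
      gauge := fun _ _ => 0, gauge_nonneg := fun _ _ => le_rfl, transport := id }
    (fun _ => Nat.succ_le_succ (Nat.zero_le _))
    (fun X => X.2.1) (fun X μ => (((X.2.2 μ).val / L ^ n : ℕ) : ZMod (fine (L ^ (X.1 + 1)) M μ)))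
    (fun X => X.2.2) (fun X μ => coarse_val hLn X.2.2 μ) _ _ (fun _ _ _ => rfl) (fun _ _ _ => rfl) W

/-! ## §6 The model ALSO inhabits the one-run envelope shape `DecayBound` (N18's N10∕NODE-A in-edge face, `κ = 0`)

Ref-B's A6 in full: under one-run envelopes `DecayBound EA W A κ`, `DecayBound EB W A κ` the node statement with ANY
`θ ≥ 1` is automatic (`BalabanUVNodesN18End.ne5_of_decayBounds_one_le`, constant `2A`); the model carries the envelopes
(King's uniform size bound, `abs_minimiser_kernel_le_unif`) AND the rate `θ = L^{−γ} < 1` — the content is the rate. -/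

/-- King's uniform size bound with a level coefficient `a_j` majorised by `a`: `|ψ(x)| ≤ A(a, d)` for the minimiser with
coefficient `a_j` on ANY odd fine torus, `A = (π∕2)^d[(π²∕4)^{d+1} + a(π²∕4)C(d, −1)]`, every volume and mass.
[cite: King1986, Prop. 3.7 ∕ Thm 3.3 (size half) p.664, (4.2) p.670, (4.22) p.672] -/
theorem abs_kernel_le_unif (hd : 0 < d) {L : ℕ} (hL : 2 ≤ L) {N : ℕ} [NeZero N] (hNodd : Odd N) (hN1 : 1 ≤ N)
    {j : ℕ} (hj : 1 ≤ j) (M : Fin d → ℕ) [∀ μ, NeZero (M μ)] {a m2 : ℝ} (ha : 0 < a) (hm : 0 < m2) (b : Tor M)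
    (x : Tor (fine N M)) :
    |minimiser N M (aK a L j) ((N : ℝ) ^ 2) m2 (Pi.single b 1) x|
      ≤ (π / 2) ^ d * ((π ^ 2 / 4) ^ d * (π ^ 2 / 4) + a * (π ^ 2 / 4) * aliasConst d (-1)) := by
  have hLr : (1 : ℝ) < L := by exact_mod_cast (lt_of_lt_of_le one_lt_two hL)
  have h := abs_minimiser_kernel_le_unif hd hNodd hN1 M (aK_pos ha hLr hj) hm b x
  have hAC : 0 ≤ aliasConst d (-1) :=
    (Finset.sum_nonneg fun j _ => aliasTerm_nonneg (-1) _ j).trans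
      (alias_sum_le hd (by norm_num) (p := fun _ => 0) (fun μ => by rw [abs_zero]; exact pi_pos.le) 0)
  have hle : aK a L j * (π ^ 2 / 4) * aliasConst d (-1) ≤ a * (π ^ 2 / 4) * aliasConst d (-1) :=
    mul_le_mul_of_nonneg_right (mul_le_mul_of_nonneg_right (aK_le ha hLr hj) (by positivity)) hAC
  exact h.trans (mul_le_mul_of_nonneg_left (by linarith) (pow_nonneg (by positivity) d))

/-- **Run A of the model inhabits `DecayBound` with `κ = 0`** (the (0.25)-shape one-run envelope N18's knit takes from
N10∕NODE A as binder `hA1`), ONE constant for all scales, volumes and masses. [cite: King1986, Thm 3.3 p.664, (4.2) p.670] -/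
theorem decayBound_of_kingModel_A (hd : 0 < d) {L : ℕ} [NeZero L] (hLodd : Odd L) (hL : 2 ≤ L)
    (M : Fin d → ℕ) [∀ μ, NeZero (M μ)] {a m2 : ℝ} (ha : 0 < a) (hm : 0 < m2)
    (C : Carriers) (hscale : ∀ X, 1 ≤ C.scale X) (site : C.Dom → Tor M)
    (xA : (X : C.Dom) → Tor (fine (L ^ C.scale X) M)) (EA : Functional C C.BgA)
    (hEA : ∀ g U X, EA g U X =
      minimiser (L ^ C.scale X) M (aK a L (C.scale X)) (((L ^ C.scale X : ℕ) : ℝ) ^ 2) m2 (Pi.single (site X) 1) (xA X))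
    (W : Set (ℕ → ℝ)) :
    DecayBound EA W ((π / 2) ^ d * ((π ^ 2 / 4) ^ d * (π ^ 2 / 4) + a * (π ^ 2 / 4) * aliasConst d (-1))) 0 := by
  intro g _hg U X
  rw [hEA, zero_mul, neg_zero, Real.exp_zero, mul_one]
  exact abs_kernel_le_unif hd hL hLodd.pow (Nat.pos_of_neZero _) (hscale X) M ha hm (site X) (xA X)

/-- **Run B likewise** (binder `hB1`): `ℋ_{k+n}` on the finer torus of `L^nL^k` points, coefficient `a_{k+n}`.
[cite: King1986, Thm 3.3 p.664, (4.2) p.670] -/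
theorem decayBound_of_kingModel_B (hd : 0 < d) {L : ℕ} [NeZero L] (hLodd : Odd L) (hL : 2 ≤ L) (n : ℕ)
    (M : Fin d → ℕ) [∀ μ, NeZero (M μ)] {a m2 : ℝ} (ha : 0 < a) (hm : 0 < m2)
    (C : Carriers) (hscale : ∀ X, 1 ≤ C.scale X) (site : C.Dom → Tor M)
    (xB : (X : C.Dom) → Tor (fine (L ^ n * L ^ C.scale X) M)) (EB : Functional C C.BgB)
    (hEB : ∀ g U X, EB g U X =
      minimiser (L ^ n * L ^ C.scale X) M (aK a L (C.scale X + n)) (((L ^ n * L ^ C.scale X : ℕ) : ℝ) ^ 2) m2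
        (Pi.single (site X) 1) (xB X))
    (W : Set (ℕ → ℝ)) :
    DecayBound EB W ((π / 2) ^ d * ((π ^ 2 / 4) ^ d * (π ^ 2 / 4) + a * (π ^ 2 / 4) * aliasConst d (-1))) 0 := by
  intro g _hg U X
  rw [hEB, zero_mul, neg_zero, Real.exp_zero, mul_one]
  exact abs_kernel_le_unif hd hL (hLodd.pow.mul hLodd.pow) (Nat.pos_of_neZero _)
    (by have := hscale X; omega) M ha hm (site X) (xB X)

/-! ## §7 The K4 family shape (dagwriter `N18At`: `∀ b ∈ ]0, γ′], NE5 EA (EB b) …`) for the model -/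

/-- In King's model run B has no first coupling to vary: the K4 family shape holds for the constant family.
[cite: King1986, Prop. 3.8 (3.71) p.664] -/
theorem ne5_family_of_const {C : Carriers} {EA : Functional C C.BgA} {EB : Functional C C.BgB} {W : Set (ℕ → ℝ)}
    {κ θ C₅ : ℝ} (h : NE5 EA EB W κ θ C₅) (γ' : ℝ) :
    ∀ b : ℝ, 0 < b → b ≤ γ' → NE5 EA ((fun _ : ℝ => EB) b) W κ θ C₅ :=
  fun _ _ _ => h

end Summit.QuantumFields.YangMills.BalabanUVNodes.N18KingModel

end
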